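import Summits.QuantumFields.BalabanUV.Beta.D1BFx.KLimitAxial
import Summits.QuantumFields.BalabanUV.Beta.D1BFx.TorusGaugeBasis
import Summits.QuantumFields.BalabanUV.Beta.D1BFx.SliceTransferDefectHess
import Summits.QuantumFields.BalabanUV.Beta.D1BFx.SliceTransferDefectWard

/-!
# `BalabanUV.Beta.D1BFx.KCombineCov` — road «BF-x» for binder row D1, slot (K), «(K) CLOSURE PLAN (R1-L)» v0 §2 (A1) **«K-TA4G-COMBINE»: THE (R1-L)
# TWIN OF `KCombine` — THE `ℤ⁴` IDENTITY OF THE COVARIANT ORGANISATION FROM THE PER-TORUS IDENTITY UNDER WARD-L AND FOUR SOCKETS** (owner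
# d1-p2-g9 (A1) SHAPE, journal 2026-08-21 l.27861).  Generic in the table families, every socket DISPLAYED.  Four legs `a k + b k = c k + 2·e k`:
# `a` = the literal's comb-slice functional (leg `M_T⁻¹|` = `blocksHat (sortK (coDressKBmAt ρ n (KInvStep n 0)))`, TB1∕TB5-2b), `b` = the COVARIANT GRAM
# tower (leg `(Wᵀ(K₀+B₀)W)⁻¹` on the rooted modes), `c` = the (R1-L) N-side (leg `(kkt (K₀+B₀) Q₀)⁻¹` = `blocksHat (sortK (NlegRoad m a))`, TB5-2a), `e` = the
# comb-FP tower (leg `(τW₀)⁻¹`).  §2 = the MATRIX-currency identity delivered by `SliceTransferDefectHess.hessT_deflate_transfer_jets` ∘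
# `SliceTransferDefectWard.deflJet₀∕₁∕Mix_eq_of_wardL` under the WARD-L letters `E• = 0` taken as HYPOTHESES and the co-frame weight `B• = gram•(T•, A•)`;
# §3 = the dictionary step per torus; §4 = THE `ℤ⁴` IDENTITY
#   `hessKer G_M 𝒱M 𝒲M + hessKer G_Φ 𝒳Φ 𝒳Φ₂ = hessKer (NlegRoad m a) 𝒱N 𝒲N + 2·hessKer G_τ 𝒳τ 𝒳τ₂` (at `μ ν z`)
# modulo the array-currency identity on every torus, with the M-socket (TB5-2b `KLimitAxial.tendsto_hessT_coDressKInvStep`) and the N-socket (TB5-2a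
# `KLimitGluon.tendsto_hessT_NlegRoad`) BY NAME and the two NEW leg sockets «GRAM-COV LEG» (`tendsto_hessT_GPhi`) and «COMB-FP LEG» (`tendsto_hessT_Gtau`)
# displayed as `Tendsto` hypotheses (names reserved for the files that will prove them); §5 = the robust form with every non-M slot a limit hypothesis.

HONEST FRAMING (cell contract, verbatim): «discharging `BetaPertH` makes Bałaban's UV stability UNCONDITIONAL — a real constructive-QFT
result; it is NOT the continuum limit and NOT the Clay problem.»  HONEST DEPENDENCY (verbatim): «continuum YM on T⁴ ⇐ BetaPertH ∧ nine
spine estimates (0/9 proved); BetaPertH ⇐ (D1) ∧ (D4) ∧ CAP+tail; G-an2-4 gates asym, D1 and NE2/3/4.»  THIS MODULE DISCHARGES NOTHING of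
D1 ∕ BetaPertH: [folklore] `tendsto_nhds_unique` + compositions BY NAME of the landed (K8-L) PART 2 identities and the TB5-2a∕2b sockets.  No `def`,
no `def … : Prop`, nothing cited, 0 sorry.  DISPLAYED (what (K) still owes on this line): WARD-L for the typed literal (Q1: the letters `E• = 0` are
HYPOTHESES here, consumed in §2), the per-torus identity in array currency (= §3's dictionary letters: M-jets `× S_g`, the N-LEG letter `(kkt (K̂+B₀) Q̂)⁻¹ =
blocksHat (sortK NL)`, the N-jets, and the two tower functionals read as periodised arrays — (A1′)∕(A2)), the two new leg sockets, `Spr (Ga (m+1) a)`.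
NOT summit progress; NOT BetaPertH, NOT continuum, NOT Clay.

ABSOLUTE RULE (cell, verbatim): «No internally-minted statement may enter as a cited fact. Every hypothesis is either kernel-proved in this
package or a verbatim quotation of a PUBLISHED theorem with page reference. The manuscript(s) under audit are NOT citable for their own
disputed steps — they are the thing under adjudication; programme-internal (2001/route/tribunal) claims are never citable.»

CONTENT (all [folklore]).
* §1 `eq_of_tendsto_identity₄`, `eq_of_tendsto_identity₄_eventually` — limits of a `k`-indexed four-leg identity `a k + b k = c k + 2·e k`; `hessT_one_leg`.
* §2 `gram₀_transpose_of_symm`, `gram₁_transpose_of_symm`, `gramMix_transpose_of_symm`; **`hessT_transfer_wardL`** — MATRIX currency: for symmetric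
  form jets `K•`, co-frame data `T•`, symmetric `A•` (weight `B• = gram•(T•, A•)`), rooted-mode jets `W•`, constraint jets `Q•` with the kinematic letters,
  comb rows `τ`, the WARD-L letters `K₀W₀ = 0`, `KₛW₀ + K₀Wₛ = 0`, `KₜW₀ + K₀Wₜ = 0`, `KₛₜW₀ + KₛWₜ + KₜWₛ + K₀Wₛₜ = 0`, and `det(T₀W₀)`, `det A₀`, `det Φ₀`,
  `det(τW₀)`, `det kkt K₀ [Q₀;τ] ≠ 0`:
  `hessT ((kkt K₀ [Q₀;τ])⁻¹|; kkt K• Q•) + hessT (Φ₀⁻¹; Φ•) = hessT ((kkt (K₀+B₀) Q₀)⁻¹; kkt (K•+B•) Q•) + 2·hessT ((τW₀)⁻¹; τW•)`, `Φ• = gram• W (K+B)`.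
* §3 **`identity_array_currency_cov`** — per torus (`K₀ := Khat n p`, `Q₀ := Qhat n p`, `τ := tauT (toSite r) n p`; `det M_T ≠ 0` by
  `TorusCombKKT.isUnit_det_MT`): §2 + dictionary letters ⟹ the identity in ARRAY currency.
* §3′ **`identity_array_currency_cov_What0`** — the same at the ROOTED GAUGE BASIS `W₀ := Ŵ₀ = What0 r n p` of this lineage's `TorusGaugeBasis` (p239910):
  the order-0 letters `K̂·Ŵ₀ = 0` (WARD-L at order 0), `Q̂·Ŵ₀ = 0` (kinematic) and `τ_T·Ŵ₀ = 1` are DISCHARGED BY NAME (`Khat_mul_What0`, `Qhat_mul_What0`,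
  `tauT_mul_What0`), so the comb-FP LEG is the IDENTITY: the «COMB-FP LEG» functional is `hessT 1 (τ_T·Wₛ) (τ_T·Wₜ) (τ_T·Wₛₜ)` — a plain trace word.
* §4 **`hessKer_transfer_road_cov`** — THE `ℤ⁴` IDENTITY OF THE COVARIANT ORGANISATION (`d = 3`), M- and N-sockets BY NAME, the two new leg
  sockets as `Tendsto` hypotheses.
* §5 `hessKer_transfer_road_cov_limits` — M-side BY NAME, every other slot a limit hypothesis, eventually-exact per torus (generic `d`, `n`).
WHAT IT IS NOT: it does not prove WARD-L, does not instantiate the families ((A2): `𝒱N∕𝒲N` ↔ `SbfBal` pieces + `gram•` words; `𝒳τ` ↔ gauge-jet words;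
`𝒳Φ` ↔ new), does not supply the N-LEG letter or the two new sockets ((A1′)), does not touch the END.
Unit `b2b-balaban-beta-d1-formalise-leaf-03` (gen 10), claim «K-TA4G-COMBINE» (journal l.27869); road owner `b2b-balaban-beta-d1-p2`; template `KCombine` (p246873).
-/

noncomputable section

namespace Summit.QuantumFields.BalabanUV.Beta.D1BFx.KCombineCov

open Matrix Filter Topology
open scoped BigOperators
open Literature.Probability.LatticeModels (TorusSite Torus.proj)
open Literature.MathematicalPhysics.QuantumFieldTheory.Balaban1983to89
open Literature.MathematicalPhysics.QuantumFieldTheory.Balaban1983to89.Beta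
open Literature.MathematicalPhysics.QuantumFieldTheory.Balaban1983to89.Beta.Composition (kkt)
open ExpKernelCalculus (MKer Decays BiLoc hessKer shiftK)
open AffineAveraging (box toSite)
open OneStepResolventKernel (Fib)
open OneStepKernelFamily (KInvStep)
open Summit.QuantumFields.BalabanUV.Beta.TameKernelCalculus (Spr)
open Summit.QuantumFields.BalabanUV.Beta.AxialDressingRooted (coDressKBmAt)
open Summit.QuantumFields.BalabanUV.Beta.D1BFx.FibredPeriodisation (periodiseF)
open Summit.QuantumFields.BalabanUV.Beta.D1BFx.SortedKernels (blocksHat)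
open Summit.QuantumFields.BalabanUV.Beta.D1BFx.SortedPack (sortK)
open Summit.QuantumFields.BalabanUV.Beta.D1BFx.PeriodicArrays (arr toF)
open Summit.QuantumFields.BalabanUV.Beta.D1BFx.MixedVarPackedHess (hessT)
open Summit.QuantumFields.BalabanUV.Beta.D1BFx.GramWeightJets (gram₀ gram₁)
open Summit.QuantumFields.BalabanUV.Beta.D1BFx.GramWeightJetsMixed (gramMix)
open Summit.QuantumFields.BalabanUV.Beta.D1BFx.SliceTransferDefectJets (deflJet₀ deflJet₁ deflJetMix)
open Summit.QuantumFields.BalabanUV.Beta.D1BFx.SliceTransferDefectHess (hessT_deflate_transfer_jets)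
open Summit.QuantumFields.BalabanUV.Beta.D1BFx.SliceTransferDefectWard (deflJet₀_eq_of_wardL deflJet₁_eq_of_wardL deflJetMix_eq_of_wardL)
open Summit.QuantumFields.BalabanUV.Beta.D1BFx.TorusCombKKT (I J CombRows tauT Khat Qhat isUnit_det_MT)
open Summit.QuantumFields.BalabanUV.Beta.D1BFx.TorusGaugeBasis (What0 tauT_mul_What0 Khat_mul_What0 Qhat_mul_What0)
open Summit.QuantumFields.BalabanUV.Beta.D1BFx.RWeightedLegPack (NlegRoad)
open Summit.QuantumFields.BalabanUV.Beta.D1BFx.KLimitGluon (tendsto_hessT_NlegRoad)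
open Summit.QuantumFields.BalabanUV.Beta.D1BFx.KLimitAxial (hessT_inv_MT_corner tendsto_hessT_coDressKInvStep)

/-! ## §1 Limits of a `k`-indexed four-leg identity -/

/-- [folklore] If `a k + b k = c k + 2·e k` for every `k` and the four sequences converge, the limits satisfy the same identity. -/
theorem eq_of_tendsto_identity₄ {a b c e : ℕ → ℝ} {A B C E : ℝ} (h : ∀ k, a k + b k = c k + 2 * e k)
    (ha : Tendsto a atTop (𝓝 A)) (hb : Tendsto b atTop (𝓝 B)) (hc : Tendsto c atTop (𝓝 C)) (he : Tendsto e atTop (𝓝 E)) :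
    A + B = C + 2 * E := by
  have h1 : Tendsto (fun k => a k + b k) atTop (𝓝 (A + B)) := ha.add hb
  have h2 : Tendsto (fun k => a k + b k) atTop (𝓝 (C + 2 * E)) := by
    simp only [h]; exact hc.add (he.const_mul 2)
  exact tendsto_nhds_unique h1 h2

/-- [folklore] The same for an EVENTUALLY valid identity. -/
theorem eq_of_tendsto_identity₄_eventually {a b c e : ℕ → ℝ} {A B C E : ℝ} (h : ∀ᶠ k in atTop, a k + b k = c k + 2 * e k)
    (ha : Tendsto a atTop (𝓝 A)) (hb : Tendsto b atTop (𝓝 B)) (hc : Tendsto c atTop (𝓝 C)) (he : Tendsto e atTop (𝓝 E)) :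
    A + B = C + 2 * E := by
  have h1 : Tendsto (fun k => a k + b k) atTop (𝓝 (A + B)) := ha.add hb
  exact tendsto_nhds_unique (h1.congr' h) (hc.add (he.const_mul 2))

/-- [folklore] With the IDENTITY leg the one-loop functional is a plain trace word: `hessT 1 V V′ W = ½·(tr W − tr (V·V′))` (the shape of the «COMB-FP LEG»
functional at the rooted gauge basis, §3′). -/
theorem hessT_one_leg {ι : Type*} [Fintype ι] [DecidableEq ι] (V V' W : Matrix ι ι ℝ) :
    hessT (1 : Matrix ι ι ℝ) V V' W = (1 / 2) * (W.trace - (V * V').trace) := by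
  unfold hessT
  rw [Matrix.one_mul, Matrix.one_mul, Matrix.one_mul]

/-! ## §2 Matrix currency: the slice transfer under WARD-L with the co-frame weight -/

section WardL

variable {ν μ ρ : Type*} [Fintype ν] [Fintype μ] [Fintype ρ] [DecidableEq ν] [DecidableEq μ] [DecidableEq ρ]

omit [Fintype ν] [Fintype μ] [DecidableEq ν] [DecidableEq μ] [DecidableEq ρ] in
/-- [folklore] A co-frame weight `gram₀ T A = TᵀAT` with symmetric `A` is symmetric. -/
theorem gram₀_transpose_of_symm (T : Matrix ρ ν ℝ) {A : Matrix ρ ρ ℝ} (hA : Aᵀ = A) : (gram₀ T A)ᵀ = gram₀ T A := by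
  simp only [gram₀, Matrix.transpose_mul, Matrix.transpose_transpose, hA, Matrix.mul_assoc]

omit [Fintype ν] [Fintype μ] [DecidableEq ν] [DecidableEq μ] [DecidableEq ρ] in
/-- [folklore] The first jet of a co-frame weight with symmetric `A₀`, `Aₛ` is symmetric. -/
theorem gram₁_transpose_of_symm (T₀ Tₛ : Matrix ρ ν ℝ) {A₀ Aₛ : Matrix ρ ρ ℝ} (hA₀ : A₀ᵀ = A₀) (hAₛ : Aₛᵀ = Aₛ) :
    (gram₁ T₀ Tₛ A₀ Aₛ)ᵀ = gram₁ T₀ Tₛ A₀ Aₛ := by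
  simp only [gram₁, Matrix.transpose_add, Matrix.transpose_mul, Matrix.transpose_transpose, hA₀, hAₛ, Matrix.add_mul, Matrix.mul_assoc]
  abel

omit [Fintype ν] [Fintype μ] [DecidableEq ν] [DecidableEq μ] [DecidableEq ρ] in
/-- [folklore] The mixed second jet of a co-frame weight with symmetric `A•` is symmetric. -/
theorem gramMix_transpose_of_symm (T₀ Tₛ Tₜ Tₛₜ : Matrix ρ ν ℝ) {A₀ Aₛ Aₜ Aₛₜ : Matrix ρ ρ ℝ} (hA₀ : A₀ᵀ = A₀) (hAₛ : Aₛᵀ = Aₛ)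
    (hAₜ : Aₜᵀ = Aₜ) (hAₛₜ : Aₛₜᵀ = Aₛₜ) :
    (gramMix T₀ Tₛ Tₜ Tₛₜ A₀ Aₛ Aₜ Aₛₜ)ᵀ = gramMix T₀ Tₛ Tₜ Tₛₜ A₀ Aₛ Aₜ Aₛₜ := by
  simp only [gramMix, Matrix.transpose_add, Matrix.transpose_mul, Matrix.transpose_transpose, hA₀, hAₛ, hAₜ, hAₛₜ, Matrix.mul_assoc]
  abel

/-- [folklore] **THE SLICE TRANSFER IN MATRIX CURRENCY UNDER WARD-L, CO-FRAME WEIGHT** ((K8-L) PART 2b `hessT_deflate_transfer_jets` ∘ PART 2c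
`deflJet•_eq_of_wardL`).  For symmetric form jets `K•`, co-frame data `T•` with symmetric `A•` (weight jets `B• := gram•(T•, A•)`), rooted-mode jets `W•`,
constraint jets `Q•` with the kinematic letters `Q₀W₀ = 0`, …, comb rows `τ`, the WARD-L letters (hypotheses) and the non-degeneracies:
`hessT ((kkt K₀ [Q₀;τ])⁻¹|_{ν⊕μ}; kkt Kₛ Qₛ, kkt Kₜ Qₜ, kkt Kₛₜ Qₛₜ) + hessT (Φ₀⁻¹; Φₛ, Φₜ, Φₛₜ) = hessT ((kkt (K₀+B₀) Q₀)⁻¹; kkt (K•+B•) Q•) + 2·hessT ((τW₀)⁻¹; τWₛ, τWₜ, τWₛₜ)`,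
`Φ• := gram• W (K + B)` — the deflated jets of `K + B` ARE `K•` under the letters, so the sharp functional is the literal's. -/
theorem hessT_transfer_wardL (K₀ Kₛ Kₜ Kₛₜ : Matrix ν ν ℝ) (T₀ Tₛ Tₜ Tₛₜ : Matrix ρ ν ℝ) (A₀ Aₛ Aₜ Aₛₜ : Matrix ρ ρ ℝ)
    (W₀ Wₛ Wₜ Wₛₜ : Matrix ν ρ ℝ) (Q₀ Qₛ Qₜ Qₛₜ : Matrix μ ν ℝ) (τ : Matrix ρ ν ℝ)
    (hK₀ : K₀ᵀ = K₀) (hKₛ : Kₛᵀ = Kₛ) (hKₜ : Kₜᵀ = Kₜ) (hKₛₜ : Kₛₜᵀ = Kₛₜ)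
    (hA₀ : A₀ᵀ = A₀) (hAₛ : Aₛᵀ = Aₛ) (hAₜ : Aₜᵀ = Aₜ) (hAₛₜ : Aₛₜᵀ = Aₛₜ)
    (hE₀ : K₀ * W₀ = 0) (hEₛ : Kₛ * W₀ + K₀ * Wₛ = 0) (hEₜ : Kₜ * W₀ + K₀ * Wₜ = 0)
    (hEₛₜ : Kₛₜ * W₀ + Kₛ * Wₜ + Kₜ * Wₛ + K₀ * Wₛₜ = 0)
    (b0 : Q₀ * W₀ = 0) (bₛ : Qₛ * W₀ + Q₀ * Wₛ = 0) (bₜ : Qₜ * W₀ + Q₀ * Wₜ = 0)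
    (bₛₜ : Qₛₜ * W₀ + Qₛ * Wₜ + Qₜ * Wₛ + Q₀ * Wₛₜ = 0)
    (hTW : (T₀ * W₀).det ≠ 0) (hA : A₀.det ≠ 0) (hΦ : (gram₀ W₀ (K₀ + gram₀ T₀ A₀)).det ≠ 0) (hτ : (τ * W₀).det ≠ 0)
    (hM : (kkt K₀ (fromRows Q₀ τ)).det ≠ 0) :
    hessT ((kkt K₀ (fromRows Q₀ τ))⁻¹.submatrix (Sum.map id Sum.inl) (Sum.map id Sum.inl)) (kkt Kₛ Qₛ) (kkt Kₜ Qₜ) (kkt Kₛₜ Qₛₜ)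
      + hessT (gram₀ W₀ (K₀ + gram₀ T₀ A₀))⁻¹ (gram₁ W₀ Wₛ (K₀ + gram₀ T₀ A₀) (Kₛ + gram₁ T₀ Tₛ A₀ Aₛ))
          (gram₁ W₀ Wₜ (K₀ + gram₀ T₀ A₀) (Kₜ + gram₁ T₀ Tₜ A₀ Aₜ))
          (gramMix W₀ Wₛ Wₜ Wₛₜ (K₀ + gram₀ T₀ A₀) (Kₛ + gram₁ T₀ Tₛ A₀ Aₛ) (Kₜ + gram₁ T₀ Tₜ A₀ Aₜ)
            (Kₛₜ + gramMix T₀ Tₛ Tₜ Tₛₜ A₀ Aₛ Aₜ Aₛₜ))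
    = hessT (kkt (K₀ + gram₀ T₀ A₀) Q₀)⁻¹ (kkt (Kₛ + gram₁ T₀ Tₛ A₀ Aₛ) Qₛ) (kkt (Kₜ + gram₁ T₀ Tₜ A₀ Aₜ) Qₜ)
        (kkt (Kₛₜ + gramMix T₀ Tₛ Tₜ Tₛₜ A₀ Aₛ Aₜ Aₛₜ) Qₛₜ)
      + 2 * hessT (τ * W₀)⁻¹ (τ * Wₛ) (τ * Wₜ) (τ * Wₛₜ) := by
  -- transposed Ward letters from symmetry
  have hE₀t : K₀ᵀ * W₀ = 0 := by rw [hK₀]; exact hE₀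
  have hEₛt : Kₛᵀ * W₀ + K₀ᵀ * Wₛ = 0 := by rw [hKₛ, hK₀]; exact hEₛ
  have hEₜt : Kₜᵀ * W₀ + K₀ᵀ * Wₜ = 0 := by rw [hKₜ, hK₀]; exact hEₜ
  have hEₛₜt : Kₛₜᵀ * W₀ + Kₛᵀ * Wₜ + Kₜᵀ * Wₛ + K₀ᵀ * Wₛₜ = 0 := by rw [hKₛₜ, hKₛ, hKₜ, hK₀]; exact hEₛₜ
  -- symmetric totals `Y• = K• + B•`
  have hY₀ : (K₀ + gram₀ T₀ A₀)ᵀ = K₀ + gram₀ T₀ A₀ := by rw [Matrix.transpose_add, hK₀, gram₀_transpose_of_symm T₀ hA₀]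
  have hYₛ : (Kₛ + gram₁ T₀ Tₛ A₀ Aₛ)ᵀ = Kₛ + gram₁ T₀ Tₛ A₀ Aₛ := by
    rw [Matrix.transpose_add, hKₛ, gram₁_transpose_of_symm T₀ Tₛ hA₀ hAₛ]
  have hYₜ : (Kₜ + gram₁ T₀ Tₜ A₀ Aₜ)ᵀ = Kₜ + gram₁ T₀ Tₜ A₀ Aₜ := by
    rw [Matrix.transpose_add, hKₜ, gram₁_transpose_of_symm T₀ Tₜ hA₀ hAₜ]
  have hYₛₜ : (Kₛₜ + gramMix T₀ Tₛ Tₜ Tₛₜ A₀ Aₛ Aₜ Aₛₜ)ᵀ = Kₛₜ + gramMix T₀ Tₛ Tₜ Tₛₜ A₀ Aₛ Aₜ Aₛₜ := by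
    rw [Matrix.transpose_add, hKₛₜ, gramMix_transpose_of_symm T₀ Tₛ Tₜ Tₛₜ hA₀ hAₛ hAₜ hAₛₜ]
  -- the deflated jets ARE the form jets under the letters
  have d0 := deflJet₀_eq_of_wardL (K₀ := K₀) (T₀ := T₀) (A₀ := A₀) (W₀ := W₀) hE₀ hE₀t hA₀ hTW hA
  have d1s := deflJet₁_eq_of_wardL (K₀ := K₀) (Kₛ := Kₛ) (T₀ := T₀) (Tₛ := Tₛ) (A₀ := A₀) (Aₛ := Aₛ) (W₀ := W₀) (Wₛ := Wₛ)
    hE₀ hE₀t hEₛ hEₛt hA₀ hAₛ hTW hA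
  have d1t := deflJet₁_eq_of_wardL (K₀ := K₀) (Kₛ := Kₜ) (T₀ := T₀) (Tₛ := Tₜ) (A₀ := A₀) (Aₛ := Aₜ) (W₀ := W₀) (Wₛ := Wₜ)
    hE₀ hE₀t hEₜ hEₜt hA₀ hAₜ hTW hA
  have dm := deflJetMix_eq_of_wardL (K₀ := K₀) (Kₛ := Kₛ) (Kₜ := Kₜ) (Kₛₜ := Kₛₜ) (T₀ := T₀) (Tₛ := Tₛ) (Tₜ := Tₜ) (Tₛₜ := Tₛₜ)
    (A₀ := A₀) (Aₛ := Aₛ) (Aₜ := Aₜ) (Aₛₜ := Aₛₜ) (W₀ := W₀) (Wₛ := Wₛ) (Wₜ := Wₜ) (Wₛₜ := Wₛₜ)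
    hE₀ hE₀t hEₛ hEₛt hEₜ hEₜt hEₛₜ hEₛₜt hA₀ hAₛ hAₜ hAₛₜ hTW hA
  have hM' : (kkt (deflJet₀ (K₀ + gram₀ T₀ A₀) W₀) (fromRows Q₀ τ)).det ≠ 0 := by rw [d0]; exact hM
  have h := hessT_deflate_transfer_jets (K₀ + gram₀ T₀ A₀) (Kₛ + gram₁ T₀ Tₛ A₀ Aₛ) (Kₜ + gram₁ T₀ Tₜ A₀ Aₜ)
    (Kₛₜ + gramMix T₀ Tₛ Tₜ Tₛₜ A₀ Aₛ Aₜ Aₛₜ) W₀ Wₛ Wₜ Wₛₜ Q₀ Qₛ Qₜ Qₛₜ τ hY₀ hYₛ hYₜ hYₛₜ b0 bₛ bₜ bₛₜ hΦ hτ hM'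
  rw [d0, d1s, d1t, dm] at h
  exact h

end WardL

/-! ## §3 Per torus: matrix currency under WARD-L + dictionary letters ⟹ array currency -/

section Dictionary

variable {d n : ℕ} [NeZero n] {r : Fin (d + 1) → ℕ} (p : ℕ) [NeZero p]

/-- [folklore] **THE DICTIONARY STEP, PER TORUS** ((A1) §2).  On the coarse torus `p` (fine side `n`, in-block root `r`): with `K₀ := K̂`, `Q₀ := Q̂`,
`τ := τ_T` (so `det M_T ≠ 0` is `TorusCombKKT.isUnit_det_MT`), the §2 hypotheses on the remaining jets, and the DICTIONARY letters — M-jets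
`kkt K• Q• · S_g = AM•` (TB4 (T1)), N-LEG `(kkt (K̂ + gram₀ T₀ A₀) Q̂)⁻¹ = blocksHat p (sortK n NL)`, N-jets `kkt (K•+B•) Q• = AN•`, the covariant
Gram functional `= bΦ` and the comb-FP functional `= eτ` (their array readings are the two new sockets' business) — the identity holds in ARRAY
currency: `hessT (blocksHat p (sortK n (coDressKBmAt (toSite r) n (KInvStep n 0))); AM•) + bΦ = hessT (blocksHat p (sortK n NL); AN•) + 2·eτ`. -/
theorem identity_array_currency_cov (hr : r ∈ box (d + 1) n)
    (Kₛ Kₜ Kₛₜ : Matrix (I d n p) (I d n p) ℝ)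
    (T₀ Tₛ Tₜ Tₛₜ : Matrix (CombRows (toSite r) n p) (I d n p) ℝ)
    (A₀ Aₛ Aₜ Aₛₜ : Matrix (CombRows (toSite r) n p) (CombRows (toSite r) n p) ℝ)
    (W₀ Wₛ Wₜ Wₛₜ : Matrix (I d n p) (CombRows (toSite r) n p) ℝ) (Qₛ Qₜ Qₛₜ : Matrix (J d p) (I d n p) ℝ)
    (hK₀ : (Khat (d := d) n p)ᵀ = Khat n p) (hKₛ : Kₛᵀ = Kₛ) (hKₜ : Kₜᵀ = Kₜ) (hKₛₜ : Kₛₜᵀ = Kₛₜ)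
    (hA₀ : A₀ᵀ = A₀) (hAₛ : Aₛᵀ = Aₛ) (hAₜ : Aₜᵀ = Aₜ) (hAₛₜ : Aₛₜᵀ = Aₛₜ)
    (hE₀ : Khat (d := d) n p * W₀ = 0) (hEₛ : Kₛ * W₀ + Khat (d := d) n p * Wₛ = 0) (hEₜ : Kₜ * W₀ + Khat (d := d) n p * Wₜ = 0)
    (hEₛₜ : Kₛₜ * W₀ + Kₛ * Wₜ + Kₜ * Wₛ + Khat (d := d) n p * Wₛₜ = 0)
    (b0 : Qhat (d := d) n p * W₀ = 0) (bₛ : Qₛ * W₀ + Qhat (d := d) n p * Wₛ = 0) (bₜ : Qₜ * W₀ + Qhat (d := d) n p * Wₜ = 0)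
    (bₛₜ : Qₛₜ * W₀ + Qₛ * Wₜ + Qₜ * Wₛ + Qhat (d := d) n p * Wₛₜ = 0)
    (hTW : (T₀ * W₀).det ≠ 0) (hA : A₀.det ≠ 0) (hΦ : (gram₀ W₀ (Khat (d := d) n p + gram₀ T₀ A₀)).det ≠ 0)
    (hτ : (tauT (toSite r) n p * W₀).det ≠ 0)
    {NL : MKer (d + 1) (Fib d)} (AM AM' AM'' AN AN' AN'' : Matrix (I d n p ⊕ J d p) (I d n p ⊕ J d p) ℝ) (bΦ eτ : ℝ)
    (hJM : kkt Kₛ Qₛ * Matrix.fromBlocks (1 : Matrix (I d n p) (I d n p) ℝ) 0 0 (-1 : Matrix (J d p) (J d p) ℝ) = AM)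
    (hJM' : kkt Kₜ Qₜ * Matrix.fromBlocks (1 : Matrix (I d n p) (I d n p) ℝ) 0 0 (-1 : Matrix (J d p) (J d p) ℝ) = AM')
    (hJM'' : kkt Kₛₜ Qₛₜ * Matrix.fromBlocks (1 : Matrix (I d n p) (I d n p) ℝ) 0 0 (-1 : Matrix (J d p) (J d p) ℝ) = AM'')
    (hLN : (kkt (Khat (d := d) n p + gram₀ T₀ A₀) (Qhat (d := d) n p))⁻¹ = blocksHat p (sortK n NL))
    (hJN : kkt (Kₛ + gram₁ T₀ Tₛ A₀ Aₛ) Qₛ = AN) (hJN' : kkt (Kₜ + gram₁ T₀ Tₜ A₀ Aₜ) Qₜ = AN')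
    (hJN'' : kkt (Kₛₜ + gramMix T₀ Tₛ Tₜ Tₛₜ A₀ Aₛ Aₜ Aₛₜ) Qₛₜ = AN'')
    (hbΦ : hessT (gram₀ W₀ (Khat (d := d) n p + gram₀ T₀ A₀))⁻¹ (gram₁ W₀ Wₛ (Khat (d := d) n p + gram₀ T₀ A₀) (Kₛ + gram₁ T₀ Tₛ A₀ Aₛ))
          (gram₁ W₀ Wₜ (Khat (d := d) n p + gram₀ T₀ A₀) (Kₜ + gram₁ T₀ Tₜ A₀ Aₜ))
          (gramMix W₀ Wₛ Wₜ Wₛₜ (Khat (d := d) n p + gram₀ T₀ A₀) (Kₛ + gram₁ T₀ Tₛ A₀ Aₛ) (Kₜ + gram₁ T₀ Tₜ A₀ Aₜ)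
            (Kₛₜ + gramMix T₀ Tₛ Tₜ Tₛₜ A₀ Aₛ Aₜ Aₛₜ)) = bΦ)
    (heτ : hessT (tauT (toSite r) n p * W₀)⁻¹ (tauT (toSite r) n p * Wₛ) (tauT (toSite r) n p * Wₜ) (tauT (toSite r) n p * Wₛₜ) = eτ) :
    hessT (blocksHat p (sortK n (coDressKBmAt (toSite r) n (KInvStep (d := d) n 0)))) AM AM' AM'' + bΦ
      = hessT (blocksHat p (sortK n NL)) AN AN' AN'' + 2 * eτ := by
  have h := hessT_transfer_wardL (Khat n p) Kₛ Kₜ Kₛₜ T₀ Tₛ Tₜ Tₛₜ A₀ Aₛ Aₜ Aₛₜ W₀ Wₛ Wₜ Wₛₜ (Qhat n p) Qₛ Qₜ Qₛₜ (tauT (toSite r) n p)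
    hK₀ hKₛ hKₜ hKₛₜ hA₀ hAₛ hAₜ hAₛₜ hE₀ hEₛ hEₜ hEₛₜ b0 bₛ bₜ bₛₜ hTW hA hΦ hτ (isUnit_det_MT (d := d) hr p).ne_zero
  rw [hessT_inv_MT_corner hr p, hJM, hJM', hJM'', hLN, hJN, hJN', hJN'', hbΦ, heτ] at h
  exact h

/-- [folklore] **THE DICTIONARY STEP AT THE ROOTED GAUGE BASIS `W₀ := Ŵ₀`** (`What0 r n p = (1 − Π̂)·τ_Tᵀ`, this lineage's `TorusGaugeBasis`, p239910): the
order-0 WARD-L letter `K̂·Ŵ₀ = 0`, the order-0 kinematic letter `Q̂·Ŵ₀ = 0` and `τ_T·Ŵ₀ = 1` are theorems of the tree, so they DISAPPEAR from the hypotheses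
and the comb-FP leg is the identity — the «COMB-FP LEG» functional reads `hessT 1 (τ_T·Wₛ) (τ_T·Wₜ) (τ_T·Wₛₜ)`. -/
theorem identity_array_currency_cov_What0 (hr : r ∈ box (d + 1) n)
    (Kₛ Kₜ Kₛₜ : Matrix (I d n p) (I d n p) ℝ)
    (T₀ Tₛ Tₜ Tₛₜ : Matrix (CombRows (toSite r) n p) (I d n p) ℝ)
    (A₀ Aₛ Aₜ Aₛₜ : Matrix (CombRows (toSite r) n p) (CombRows (toSite r) n p) ℝ)
    (Wₛ Wₜ Wₛₜ : Matrix (I d n p) (CombRows (toSite r) n p) ℝ) (Qₛ Qₜ Qₛₜ : Matrix (J d p) (I d n p) ℝ)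
    (hK₀ : (Khat (d := d) n p)ᵀ = Khat n p) (hKₛ : Kₛᵀ = Kₛ) (hKₜ : Kₜᵀ = Kₜ) (hKₛₜ : Kₛₜᵀ = Kₛₜ)
    (hA₀ : A₀ᵀ = A₀) (hAₛ : Aₛᵀ = Aₛ) (hAₜ : Aₜᵀ = Aₜ) (hAₛₜ : Aₛₜᵀ = Aₛₜ)
    (hEₛ : Kₛ * What0 r n p + Khat (d := d) n p * Wₛ = 0) (hEₜ : Kₜ * What0 r n p + Khat (d := d) n p * Wₜ = 0)
    (hEₛₜ : Kₛₜ * What0 r n p + Kₛ * Wₜ + Kₜ * Wₛ + Khat (d := d) n p * Wₛₜ = 0)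
    (bₛ : Qₛ * What0 r n p + Qhat (d := d) n p * Wₛ = 0) (bₜ : Qₜ * What0 r n p + Qhat (d := d) n p * Wₜ = 0)
    (bₛₜ : Qₛₜ * What0 r n p + Qₛ * Wₜ + Qₜ * Wₛ + Qhat (d := d) n p * Wₛₜ = 0)
    (hTW : (T₀ * What0 r n p).det ≠ 0) (hA : A₀.det ≠ 0) (hΦ : (gram₀ (What0 r n p) (Khat (d := d) n p + gram₀ T₀ A₀)).det ≠ 0)
    {NL : MKer (d + 1) (Fib d)} (AM AM' AM'' AN AN' AN'' : Matrix (I d n p ⊕ J d p) (I d n p ⊕ J d p) ℝ) (bΦ eτ : ℝ)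
    (hJM : kkt Kₛ Qₛ * Matrix.fromBlocks (1 : Matrix (I d n p) (I d n p) ℝ) 0 0 (-1 : Matrix (J d p) (J d p) ℝ) = AM)
    (hJM' : kkt Kₜ Qₜ * Matrix.fromBlocks (1 : Matrix (I d n p) (I d n p) ℝ) 0 0 (-1 : Matrix (J d p) (J d p) ℝ) = AM')
    (hJM'' : kkt Kₛₜ Qₛₜ * Matrix.fromBlocks (1 : Matrix (I d n p) (I d n p) ℝ) 0 0 (-1 : Matrix (J d p) (J d p) ℝ) = AM'')
    (hLN : (kkt (Khat (d := d) n p + gram₀ T₀ A₀) (Qhat (d := d) n p))⁻¹ = blocksHat p (sortK n NL))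
    (hJN : kkt (Kₛ + gram₁ T₀ Tₛ A₀ Aₛ) Qₛ = AN) (hJN' : kkt (Kₜ + gram₁ T₀ Tₜ A₀ Aₜ) Qₜ = AN')
    (hJN'' : kkt (Kₛₜ + gramMix T₀ Tₛ Tₜ Tₛₜ A₀ Aₛ Aₜ Aₛₜ) Qₛₜ = AN'')
    (hbΦ : hessT (gram₀ (What0 r n p) (Khat (d := d) n p + gram₀ T₀ A₀))⁻¹
          (gram₁ (What0 r n p) Wₛ (Khat (d := d) n p + gram₀ T₀ A₀) (Kₛ + gram₁ T₀ Tₛ A₀ Aₛ))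
          (gram₁ (What0 r n p) Wₜ (Khat (d := d) n p + gram₀ T₀ A₀) (Kₜ + gram₁ T₀ Tₜ A₀ Aₜ))
          (gramMix (What0 r n p) Wₛ Wₜ Wₛₜ (Khat (d := d) n p + gram₀ T₀ A₀) (Kₛ + gram₁ T₀ Tₛ A₀ Aₛ) (Kₜ + gram₁ T₀ Tₜ A₀ Aₜ)
            (Kₛₜ + gramMix T₀ Tₛ Tₜ Tₛₜ A₀ Aₛ Aₜ Aₛₜ)) = bΦ)
    (heτ : hessT (1 : Matrix (CombRows (toSite r) n p) (CombRows (toSite r) n p) ℝ)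
          (tauT (toSite r) n p * Wₛ) (tauT (toSite r) n p * Wₜ) (tauT (toSite r) n p * Wₛₜ) = eτ) :
    hessT (blocksHat p (sortK n (coDressKBmAt (toSite r) n (KInvStep (d := d) n 0)))) AM AM' AM'' + bΦ
      = hessT (blocksHat p (sortK n NL)) AN AN' AN'' + 2 * eτ := by
  have hτ1 : tauT (toSite r) n p * What0 r n p = 1 := tauT_mul_What0 r n p
  have hτ : (tauT (toSite r) n p * What0 r n p).det ≠ 0 := by rw [hτ1, Matrix.det_one]; exact one_ne_zero
  have heτ' : hessT (tauT (toSite r) n p * What0 r n p)⁻¹ (tauT (toSite r) n p * Wₛ) (tauT (toSite r) n p * Wₜ)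
      (tauT (toSite r) n p * Wₛₜ) = eτ := by rw [hτ1, inv_one]; exact heτ
  exact identity_array_currency_cov p hr Kₛ Kₜ Kₛₜ T₀ Tₛ Tₜ Tₛₜ A₀ Aₛ Aₜ Aₛₜ (What0 r n p) Wₛ Wₜ Wₛₜ Qₛ Qₜ Qₛₜ hK₀ hKₛ hKₜ hKₛₜ hA₀ hAₛ hAₜ hAₛₜ
    (Khat_mul_What0 r n p hr) hEₛ hEₜ hEₛₜ (Qhat_mul_What0 r n p hr) bₛ bₜ bₛₜ hTW hA hΦ hτ AM AM' AM'' AN AN' AN'' bΦ eτ hJM hJM' hJM'' hLN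
    hJN hJN' hJN'' hbΦ heτ'

end Dictionary

/-! ## §4 The `ℤ⁴` identity of the covariant organisation -/

section Combine

variable (m : ℕ) {a : ℝ} {r : Fin 4 → ℕ}

/-- [folklore] **«K-TA4G-COMBINE»: THE `ℤ⁴` IDENTITY OF THE (R1-L) ORGANISATION, MODULO THE ARRAY-CURRENCY IDENTITY ON EVERY TORUS** ((A1) §3).
For `Spr (Ga (m+1) a)`, `r ∈ box 4 (m+1)`, packed table families `𝒱M, 𝒲M` (M-side), `𝒱N, 𝒲N` (N-side), bilocalised, scalar kernels `G_Φ`, `G_τ` on the fine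
lattice with word families `𝒳Φ, 𝒳Φ₂` (covariant Gram tower) and `𝒳τ, 𝒳τ₂` (comb-FP tower), coarse periods `p k → ∞`: IF for every `k` the identity holds in
array currency on the torus `p k` (M∕N legs in sorted `blocksHat` currency, tower legs `G_Φ^`, `G_τ^` on `Site 4 ((m+1)·p k) × Unit`) AND the two NEW leg
sockets hold — «GRAM-COV LEG» `hGPhi` (reserved name `tendsto_hessT_GPhi`) and «COMB-FP LEG» `hGtau` (`tendsto_hessT_Gtau`), DISPLAYED as `Tendsto` hypotheses —
THEN on `ℤ⁴`: `hessKer G_M 𝒱M 𝒲M + hessKer G_Φ 𝒳Φ 𝒳Φ₂ = hessKer (NlegRoad m a) 𝒱N 𝒲N + 2·hessKer G_τ 𝒳τ 𝒳τ₂` at `μ ν z`,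
`G_M = coDressKBmAt (toSite r) (m+1) (KInvStep (m+1) 0)`; M-socket TB5-2b and N-socket TB5-2a BY NAME. -/
theorem hessKer_transfer_road_cov (hGa : Spr (GluonLeg.Ga (m + 1) a)) (hr : r ∈ box (3 + 1) (m + 1))
    (𝒱M : Fin 4 → (Fin 4 → ℤ) → MKer 4 (Fib 3)) (𝒲M : Fin 4 → (Fin 4 → ℤ) → Fin 4 → (Fin 4 → ℤ) → MKer 4 (Fib 3))
    (𝒱N : Fin 4 → (Fin 4 → ℤ) → MKer 4 (Fib 3)) (𝒲N : Fin 4 → (Fin 4 → ℤ) → Fin 4 → (Fin 4 → ℤ) → MKer 4 (Fib 3))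
    (GΦ : MKer 4 Unit) (𝒳Φ : Fin 4 → (Fin 4 → ℤ) → MKer 4 Unit) (𝒳Φ₂ : Fin 4 → (Fin 4 → ℤ) → Fin 4 → (Fin 4 → ℤ) → MKer 4 Unit)
    (Gτ : MKer 4 Unit) (𝒳τ : Fin 4 → (Fin 4 → ℤ) → MKer 4 Unit) (𝒳τ₂ : Fin 4 → (Fin 4 → ℤ) → Fin 4 → (Fin 4 → ℤ) → MKer 4 Unit)
    (μ ν : Fin 4) (z : Fin 4 → ℤ)
    {PM PM' QM QM' PN PN' QN QN' : Fin 4 → ℤ} {CvM CvM' CM δM CvN CvN' CN δN : ℝ}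
    (hVM : BiLoc (𝒱M μ 0) PM PM' CvM δM) (hVM' : BiLoc (𝒱M ν z) QM' QM CvM' δM) (hWM : BiLoc (𝒲M μ 0 ν z) PM QM CM δM) (hδM : 0 < δM)
    (hVN : BiLoc (𝒱N μ 0) PN PN' CvN δN) (hVN' : BiLoc (𝒱N ν z) QN' QN CvN' δN) (hWN : BiLoc (𝒲N μ 0 ν z) PN QN CN δN) (hδN : 0 < δN)
    {p : ℕ → ℕ} [∀ k, NeZero (p k)] (hp : Tendsto p atTop atTop)
    (hGPhi : Tendsto (fun k => hessT (Matrix.of (periodiseF ((m + 1) * p k) (toF GΦ)))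
        (Matrix.of (periodiseF ((m + 1) * p k) (toF (arr ((m + 1) * p k) (𝒳Φ μ 0)))))
        (Matrix.of (periodiseF ((m + 1) * p k) (toF (arr ((m + 1) * p k) (𝒳Φ ν z)))))
        (Matrix.of (periodiseF ((m + 1) * p k) (toF (arr ((m + 1) * p k) (𝒳Φ₂ μ 0 ν z)))))) atTop (𝓝 (hessKer GΦ 𝒳Φ 𝒳Φ₂ μ ν z)))
    (hGtau : Tendsto (fun k => hessT (Matrix.of (periodiseF ((m + 1) * p k) (toF Gτ)))
        (Matrix.of (periodiseF ((m + 1) * p k) (toF (arr ((m + 1) * p k) (𝒳τ μ 0)))))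
        (Matrix.of (periodiseF ((m + 1) * p k) (toF (arr ((m + 1) * p k) (𝒳τ ν z)))))
        (Matrix.of (periodiseF ((m + 1) * p k) (toF (arr ((m + 1) * p k) (𝒳τ₂ μ 0 ν z)))))) atTop (𝓝 (hessKer Gτ 𝒳τ 𝒳τ₂ μ ν z)))
    (hId : ∀ k,
      hessT (blocksHat (p k) (sortK (m + 1) (coDressKBmAt (toSite r) (m + 1) (KInvStep (d := 3) (m + 1) 0))))
          (blocksHat (p k) (sortK (m + 1) (arr ((m + 1) * p k) (𝒱M μ 0))))
          (blocksHat (p k) (sortK (m + 1) (arr ((m + 1) * p k) (𝒱M ν z))))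
          (blocksHat (p k) (sortK (m + 1) (arr ((m + 1) * p k) (𝒲M μ 0 ν z))))
        + hessT (Matrix.of (periodiseF ((m + 1) * p k) (toF GΦ)))
          (Matrix.of (periodiseF ((m + 1) * p k) (toF (arr ((m + 1) * p k) (𝒳Φ μ 0)))))
          (Matrix.of (periodiseF ((m + 1) * p k) (toF (arr ((m + 1) * p k) (𝒳Φ ν z)))))
          (Matrix.of (periodiseF ((m + 1) * p k) (toF (arr ((m + 1) * p k) (𝒳Φ₂ μ 0 ν z)))))
      = hessT (blocksHat (p k) (sortK (m + 1) (NlegRoad m a)))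
          (blocksHat (p k) (sortK (m + 1) (arr ((m + 1) * p k) (𝒱N μ 0))))
          (blocksHat (p k) (sortK (m + 1) (arr ((m + 1) * p k) (𝒱N ν z))))
          (blocksHat (p k) (sortK (m + 1) (arr ((m + 1) * p k) (𝒲N μ 0 ν z))))
        + 2 * hessT (Matrix.of (periodiseF ((m + 1) * p k) (toF Gτ)))
          (Matrix.of (periodiseF ((m + 1) * p k) (toF (arr ((m + 1) * p k) (𝒳τ μ 0)))))
          (Matrix.of (periodiseF ((m + 1) * p k) (toF (arr ((m + 1) * p k) (𝒳τ ν z)))))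
          (Matrix.of (periodiseF ((m + 1) * p k) (toF (arr ((m + 1) * p k) (𝒳τ₂ μ 0 ν z)))))) :
    hessKer (coDressKBmAt (toSite r) (m + 1) (KInvStep (d := 3) (m + 1) 0)) 𝒱M 𝒲M μ ν z + hessKer GΦ 𝒳Φ 𝒳Φ₂ μ ν z
      = hessKer (NlegRoad m a) 𝒱N 𝒲N μ ν z + 2 * hessKer Gτ 𝒳τ 𝒳τ₂ μ ν z :=
  eq_of_tendsto_identity₄ hId
    (tendsto_hessT_coDressKInvStep (d := 3) hr 𝒱M 𝒲M μ ν z hVM hVM' hWM hδM hp)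
    hGPhi
    (tendsto_hessT_NlegRoad m hGa 𝒱N 𝒲N μ ν z hVN hVN' hWN hδN hp)
    hGtau

end Combine

/-! ## §5 The robust form: M-side BY NAME, every other slot a limit hypothesis, eventually-exact per torus -/

section CombineLimits

variable {d : ℕ} {n : ℕ} [NeZero n] {r : Fin (d + 1) → ℕ}

/-- [folklore] **«K-TA4G-COMBINE», ROBUST FORM**: for the M-side literal (`coDressKBmAt (toSite r) n (KInvStep n 0)`, fixed `ℤ^{d+1}` families `𝒱M`, `𝒲M`)
the slice-sorted torus functional converges by TB5-2b; if the covariant-Gram, N-side and comb-FP torus functionals `b k`, `c k`, `e k` converge to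
`B`, `C`, `E` and the per-torus identity `hessT(M-side at k) + b k = c k + 2·e k` holds for all large `k`, then `hessKer G_M 𝒱M 𝒲M μ ν z + B = C + 2·E`. -/
theorem hessKer_transfer_road_cov_limits (hr : r ∈ box (d + 1) n)
    (𝒱M : Fin (d + 1) → (Fin (d + 1) → ℤ) → MKer (d + 1) (Fib d))
    (𝒲M : Fin (d + 1) → (Fin (d + 1) → ℤ) → Fin (d + 1) → (Fin (d + 1) → ℤ) → MKer (d + 1) (Fib d))
    (μ ν : Fin (d + 1)) (z : Fin (d + 1) → ℤ) {PM PM' QM QM' : Fin (d + 1) → ℤ} {CvM CvM' CM δM : ℝ}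
    (hVM : BiLoc (𝒱M μ 0) PM PM' CvM δM) (hVM' : BiLoc (𝒱M ν z) QM' QM CvM' δM) (hWM : BiLoc (𝒲M μ 0 ν z) PM QM CM δM) (hδM : 0 < δM)
    {p : ℕ → ℕ} [∀ k, NeZero (p k)] (hp : Tendsto p atTop atTop)
    {b c e : ℕ → ℝ} {B C E : ℝ}
    (hb : Tendsto b atTop (𝓝 B)) (hc : Tendsto c atTop (𝓝 C)) (he : Tendsto e atTop (𝓝 E))
    (hId : ∀ᶠ k in atTop,
      hessT (blocksHat (p k) (sortK n (coDressKBmAt (toSite r) n (KInvStep (d := d) n 0))))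
          (blocksHat (p k) (sortK n (arr (n * p k) (𝒱M μ 0))))
          (blocksHat (p k) (sortK n (arr (n * p k) (𝒱M ν z))))
          (blocksHat (p k) (sortK n (arr (n * p k) (𝒲M μ 0 ν z))))
        + b k = c k + 2 * e k) :
    hessKer (coDressKBmAt (toSite r) n (KInvStep (d := d) n 0)) 𝒱M 𝒲M μ ν z + B = C + 2 * E :=
  eq_of_tendsto_identity₄_eventually hId (tendsto_hessT_coDressKInvStep (d := d) hr 𝒱M 𝒲M μ ν z hVM hVM' hWM hδM hp) hb hc he

end CombineLimits

end Summit.QuantumFields.BalabanUV.Beta.D1BFx.KCombineCov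

end
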